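import Summits.CriticalPhenomena.PercolationContinuityZ3.Theorems.PercNearOneGluingNoHeavyLowerTailKnQuestion8CoefficientwiseRemSPPieces
import Summits.CriticalPhenomena.PercolationContinuityZ3.Theorems.PercNearOneGluingNoHeavyLowerTailKnQuestion8CoefficientwiseGluing
import Summits.CriticalPhenomena.PercolationContinuityZ3.Theorems.PercNearOneGluingNoHeavyLowerTailKnQuestion8CoefficientwiseTrivialCoreFlip
import HarnessLib

/-!
# THEOREM U3-CLOSURE, series step: the red-through classes `R0`, `R1` of a series composition in terms of the pieces — prim-lf-2 gen 69

Support file (`--supports stmt-CriticalPhenomena-4575`, closed), prover `prim-lf-2` (gen 69).  No definitions, no named facts, no sorries; standard axioms.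
Memo `prim-lf-2/CW-SP-gen69.md` §4.2 (SERIES) with the definitions of `…CoefficientwiseRemSPPieces.lean`.

Setting: disjoint edge sets `D₁` (terminals `x`, `m`) and `D₂` (terminals `m`, `h`), `x, m, h` pairwise distinct, whose edges share only the junction `m`, `x` on no edge
of `D₂`, `h` on no edge of `D₁`; `D = D₁ ∪ D₂` with terminals `x, h` (series composition); `C_a(s) = openCluster (ends '' s) a`.  By the one-vertex gluing lemma
`mem_openCluster_union_glue`: `C_x^D(s₁ ∪ s₂) = C_x(s₁) ∪ [m ∈ C_x s₁]·C_m(s₂)`, `C_x^D(D ∖ (s₁∪s₂)) = C_x(D₁∖s₁) ∪ [m ∈ C_x(D₁∖s₁)]·C_m(D₂∖s₂)`, and symmetrically from `h`.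
* `Coefficientwise.series_pieceR_iff` — for `s₁ ⊆ D₁`, `s₂ ⊆ D₂`, the classes `pieceR0`/`pieceR1` of `s₁ ∪ s₂` in `(D;x,h)`: EITHER `s₁ ∈ R0/R1` of `(D₁;x,m)`
  (red-through, not blue-through), `h ∈ C_m s₂`, and the composite flag (= a target `≠ h` in `C_m s₂ ∩ C_h(D₂∖s₂)`, or `h ∈ C_m(D₂∖s₂)` together with `m ∈ W` or the
  flag of `s₁`) absent / present; OR `s₁` both-through without `x`-core and `s₂ ∈ R0/R1` of `(D₂;m,h)`.
[cite: KozmaNitzan2024, Questions 8–9 (§5.5 p. 36) (context: the Question-8 pocket covariance programme)]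
-/

namespace Summit.CriticalPhenomena.PercolationContinuityZ3.Theorems

open Finset Literature.Probability.Percolation

namespace Coefficientwise

variable {ι V : Type*} [DecidableEq ι] (ends : ι → Sym2 V)

open Classical in
/-- **The red-through classes of a series composition.**  See the module docstring. [cite: KozmaNitzan2024, Questions 8–9 (§5.5 p. 36) (context)] -/
theorem series_pieceR_iff {D₁ D₂ : Finset ι} (hdisj : Disjoint D₁ D₂) {x m h : V} (hxm : x ≠ m) (hmh : m ≠ h) (hxh : x ≠ h)
    (hsep : ∀ e ∈ D₁, ∀ e' ∈ D₂, ∀ w : V, w ∈ ends e → w ∈ ends e' → w = m)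
    (hxD₂ : ∀ e ∈ D₂, x ∉ ends e) (hhD₁ : ∀ e ∈ D₁, h ∉ ends e) (W : Set V)
    (s₁ : Finset ι) (hs₁ : s₁ ⊆ D₁) (s₂ : Finset ι) (hs₂ : s₂ ⊆ D₂) :
    (pieceR0 ends (D₁ ∪ D₂) x h W (s₁ ∪ s₂) ↔
      ( (pieceR0 ends D₁ x m W s₁ ∧ h ∈ openCluster (ends '' (↑s₂ : Set ι)) m ∧
          ¬ (∃ w ∈ W, w ≠ h ∧ w ∈ openCluster (ends '' (↑s₂ : Set ι)) m ∧ w ∈ openCluster (ends '' (↑(D₂ \ s₂) : Set ι)) h) ∧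
          ¬ (h ∈ openCluster (ends '' (↑(D₂ \ s₂) : Set ι)) m ∧ m ∈ W)) ∨
        (pieceR1 ends D₁ x m W s₁ ∧ h ∈ openCluster (ends '' (↑s₂ : Set ι)) m ∧
          ¬ (∃ w ∈ W, w ≠ h ∧ w ∈ openCluster (ends '' (↑s₂ : Set ι)) m ∧ w ∈ openCluster (ends '' (↑(D₂ \ s₂) : Set ι)) h) ∧
          h ∉ openCluster (ends '' (↑(D₂ \ s₂) : Set ι)) m) ∨
        ((m ∈ openCluster (ends '' (↑s₁ : Set ι)) x ∧ m ∈ openCluster (ends '' (↑(D₁ \ s₁) : Set ι)) x ∧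
            ∀ w ∈ W, ¬ (w ∈ openCluster (ends '' (↑s₁ : Set ι)) x ∧ w ∈ openCluster (ends '' (↑(D₁ \ s₁) : Set ι)) x)) ∧
          pieceR0 ends D₂ m h W s₂) )) ∧
    (pieceR1 ends (D₁ ∪ D₂) x h W (s₁ ∪ s₂) ↔
      ( (pieceR0 ends D₁ x m W s₁ ∧ h ∈ openCluster (ends '' (↑s₂ : Set ι)) m ∧
          ((∃ w ∈ W, w ≠ h ∧ w ∈ openCluster (ends '' (↑s₂ : Set ι)) m ∧ w ∈ openCluster (ends '' (↑(D₂ \ s₂) : Set ι)) h) ∨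
           (h ∈ openCluster (ends '' (↑(D₂ \ s₂) : Set ι)) m ∧ m ∈ W))) ∨
        (pieceR1 ends D₁ x m W s₁ ∧ h ∈ openCluster (ends '' (↑s₂ : Set ι)) m ∧
          ((∃ w ∈ W, w ≠ h ∧ w ∈ openCluster (ends '' (↑s₂ : Set ι)) m ∧ w ∈ openCluster (ends '' (↑(D₂ \ s₂) : Set ι)) h) ∨
           h ∈ openCluster (ends '' (↑(D₂ \ s₂) : Set ι)) m)) ∨
        ((m ∈ openCluster (ends '' (↑s₁ : Set ι)) x ∧ m ∈ openCluster (ends '' (↑(D₁ \ s₁) : Set ι)) x ∧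
            ∀ w ∈ W, ¬ (w ∈ openCluster (ends '' (↑s₁ : Set ι)) x ∧ w ∈ openCluster (ends '' (↑(D₁ \ s₁) : Set ι)) x)) ∧
          pieceR1 ends D₂ m h W s₂) )) := by
  set D : Finset ι := D₁ ∪ D₂ with hD
  set Cx : Finset ι → Set V := fun s => openCluster (ends '' (↑s : Set ι)) x with hCx
  set Cm : Finset ι → Set V := fun s => openCluster (ends '' (↑s : Set ι)) m with hCm
  set Ch : Finset ι → Set V := fun s => openCluster (ends '' (↑s : Set ι)) h with hCh
  ------------------------------------------------------------------
  -- 0. gluing and elementary facts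
  ------------------------------------------------------------------
  have GX : ∀ s₁, s₁ ⊆ D₁ → ∀ s₂, s₂ ⊆ D₂ → ∀ y, (y ∈ Cx (s₁ ∪ s₂) ↔ y ∈ Cx s₁ ∨ (m ∈ Cx s₁ ∧ y ∈ Cm s₂)) := by
    intro s₁ hs₁ s₂ hs₂ y
    exact mem_openCluster_union_glue ends (fun e he e' he' w hw hw' => hsep e (hs₁ he) e' (hs₂ he') w hw hw')
      (fun e he hx => absurd hx (hxD₂ e (hs₂ he))) y
  have GH : ∀ s₁, s₁ ⊆ D₁ → ∀ s₂, s₂ ⊆ D₂ → ∀ y, (y ∈ Ch (s₁ ∪ s₂) ↔ y ∈ Ch s₂ ∨ (m ∈ Ch s₂ ∧ y ∈ Cm s₁)) := by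
    intro s₁ hs₁ s₂ hs₂ y
    rw [Finset.union_comm]
    exact mem_openCluster_union_glue ends (fun e he e' he' w hw hw' => hsep e' (hs₁ he') e (hs₂ he) w hw' hw)
      (fun e he hh => absurd hh (hhD₁ e (hs₁ he))) y
  have h_notin_Cx1 : ∀ s₁, s₁ ⊆ D₁ → h ∉ Cx s₁ :=
    fun s₁ hs₁ => not_mem_openCluster_of_forall_not_mem ends (fun e he => hhD₁ e (hs₁ he)) hxh.symm
  have h_notin_Cm1 : ∀ s₁, s₁ ⊆ D₁ → h ∉ Cm s₁ :=
    fun s₁ hs₁ => not_mem_openCluster_of_forall_not_mem ends (fun e he => hhD₁ e (hs₁ he)) hmh.symm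
  have x_notin_Cm2 : ∀ s₂, s₂ ⊆ D₂ → x ∉ Cm s₂ :=
    fun s₂ hs₂ => not_mem_openCluster_of_forall_not_mem ends (fun e he => hxD₂ e (hs₂ he)) hxm
  have x_notin_Ch2 : ∀ s₂, s₂ ⊆ D₂ → x ∉ Ch s₂ :=
    fun s₂ hs₂ => not_mem_openCluster_of_forall_not_mem ends (fun e he => hxD₂ e (hs₂ he)) hxh
  have mCh_iff : ∀ s₂ : Finset ι, m ∈ Ch s₂ ↔ h ∈ Cm s₂ := fun s₂ => mem_openCluster_comm ends s₂ h m
  -- decompositions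
  have hdecomp : ∀ t, t ⊆ D → t = (t ∩ D₁) ∪ (t ∩ D₂) := by
    intro t ht; ext i
    simp only [Finset.mem_union, Finset.mem_inter]
    constructor
    · intro hi; rcases Finset.mem_union.mp (ht hi) with h1 | h2
      · exact Or.inl ⟨hi, h1⟩
      · exact Or.inr ⟨hi, h2⟩
    · rintro (⟨hi, _⟩ | ⟨hi, _⟩) <;> exact hi
  have hsdiff : ∀ s₁, s₁ ⊆ D₁ → ∀ s₂, s₂ ⊆ D₂ → D \ (s₁ ∪ s₂) = (D₁ \ s₁) ∪ (D₂ \ s₂) :=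
    fun s₁ hs₁ s₂ hs₂ => union_sdiff_union_of_subset hdisj hs₁ hs₂
  have hinter₁ : ∀ s₁, s₁ ⊆ D₁ → ∀ s₂, s₂ ⊆ D₂ → (s₁ ∪ s₂) ∩ D₁ = s₁ := by
    intro s₁ hs₁ s₂ hs₂; ext i
    simp only [Finset.mem_inter, Finset.mem_union]
    constructor
    · rintro ⟨h12 | h12, hi1⟩
      · exact h12
      · exact absurd (Finset.mem_inter.mpr ⟨hi1, hs₂ h12⟩) (Finset.disjoint_iff_inter_eq_empty.mp hdisj ▸ Finset.notMem_empty i)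
    · intro hi; exact ⟨Or.inl hi, hs₁ hi⟩
  have hinter₂ : ∀ s₁, s₁ ⊆ D₁ → ∀ s₂, s₂ ⊆ D₂ → (s₁ ∪ s₂) ∩ D₂ = s₂ := by
    intro s₁ hs₁ s₂ hs₂; ext i
    simp only [Finset.mem_inter, Finset.mem_union]
    constructor
    · rintro ⟨h12 | h12, hi2⟩
      · exact absurd (Finset.mem_inter.mpr ⟨hs₁ h12, hi2⟩) (Finset.disjoint_iff_inter_eq_empty.mp hdisj ▸ Finset.notMem_empty i)
      · exact h12
    · intro hi; exact ⟨Or.inr hi, hs₂ hi⟩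
  -- a vertex in a cluster of a D₁-colouring and in a cluster of a D₂-colouring is one of the seeds or the junction
  have cross : ∀ s₁, s₁ ⊆ D₁ → ∀ s₂, s₂ ⊆ D₂ → ∀ (a b w : V), w ∈ openCluster (ends '' (↑s₁ : Set ι)) a →
      w ∈ openCluster (ends '' (↑s₂ : Set ι)) b → w = a ∨ w = b ∨ w = m := by
    intro s₁ hs₁ s₂ hs₂ a b w hwa hwb
    by_cases hwa' : w = a
    · exact Or.inl hwa'
    by_cases hwb' : w = b
    · exact Or.inr (Or.inl hwb')
    obtain ⟨e, he, hwe⟩ := exists_edge_of_mem_openCluster ends hwa hwa'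
    obtain ⟨e', he', hwe'⟩ := exists_edge_of_mem_openCluster ends hwb hwb'
    exact Or.inr (Or.inr (hsep e (hs₁ he) e' (hs₂ he') w hwe hwe'))
  ------------------------------------------------------------------
  -- 1. component predicates (D₁ with terminals x,m; D₂ with terminals m,h) and their class dictionaries
  ------------------------------------------------------------------
  -- D₁ side
  set a₁ : Finset ι → Prop := fun s => m ∈ Cx s with ha₁
  set b₁ : Finset ι → Prop := fun s => m ∈ Cx (D₁ \ s) with hb₁
  set NX₁ : Finset ι → Prop := fun s => ∀ w ∈ W, ¬ (w ∈ Cx s ∧ w ∈ Cx (D₁ \ s)) with hNX₁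
  set FX₁ : Finset ι → Prop := fun s => ∃ w ∈ W, w ≠ m ∧ w ∈ Cx s ∧ w ∈ Cm (D₁ \ s) with hFX₁     -- f_xh of D₁ (targets ≠ m)
  set HX₁ : Finset ι → Prop := fun s => ∃ w ∈ W, w ∈ Cm s ∧ w ∈ Cx (D₁ \ s) with hHX₁             -- f_hx of D₁
  -- classes of D₁ in these terms
  have R0₁_iff : ∀ s, pieceR0 ends D₁ x m W s ↔ (a₁ s ∧ ¬ b₁ s ∧ NX₁ s ∧ ¬ FX₁ s) := by
    intro s; unfold pieceR0
    exact ⟨fun ⟨p, q, r, u⟩ => ⟨p, q, r, fun ⟨w, hw, hne, h1, h2⟩ => u w hw hne ⟨h1, h2⟩⟩,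
      fun ⟨p, q, r, u⟩ => ⟨p, q, r, fun w hw hne hh => u ⟨w, hw, hne, hh.1, hh.2⟩⟩⟩
  have R1₁_iff : ∀ s, pieceR1 ends D₁ x m W s ↔ (a₁ s ∧ ¬ b₁ s ∧ NX₁ s ∧ FX₁ s) := by
    intro s; unfold pieceR1; exact Iff.rfl
  have N₁_iff : ∀ s, pieceN ends D₁ x m W s ↔ (¬ a₁ s ∧ ¬ b₁ s ∧ NX₁ s ∧ ¬ HX₁ s ∧ (∃ w ∈ W, w ∈ Cx s ∧ w ∈ Cm (D₁ \ s))) := by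
    intro s; unfold pieceN
    exact ⟨fun ⟨p, q, r, u, v⟩ => ⟨p, q, r, fun ⟨w, hw, h1, h2⟩ => u w hw ⟨h1, h2⟩, v⟩,
      fun ⟨p, q, r, u, v⟩ => ⟨p, q, r, fun w hw hh => u ⟨w, hw, hh.1, hh.2⟩, v⟩⟩
  -- when m ∉ Cx s, the existential flag of pieceN equals FX₁ (the witness cannot be m)
  have FX₁_iff : ∀ s, ¬ a₁ s → ((∃ w ∈ W, w ∈ Cx s ∧ w ∈ Cm (D₁ \ s)) ↔ FX₁ s) := by
    intro s hna
    exact ⟨fun ⟨w, hw, h1, h2⟩ => ⟨w, hw, fun hwm => hna (by simp only [ha₁]; rw [← hwm]; exact h1), h1, h2⟩, fun ⟨w, hw, _, h1, h2⟩ => ⟨w, hw, h1, h2⟩⟩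
  -- D₂ side (terminals m, h)
  set a₂ : Finset ι → Prop := fun s => h ∈ Cm s with ha₂
  set b₂ : Finset ι → Prop := fun s => h ∈ Cm (D₂ \ s) with hb₂
  set NX₂ : Finset ι → Prop := fun s => ∀ w ∈ W, ¬ (w ∈ Cm s ∧ w ∈ Cm (D₂ \ s)) with hNX₂
  set FX₂ : Finset ι → Prop := fun s => ∃ w ∈ W, w ≠ h ∧ w ∈ Cm s ∧ w ∈ Ch (D₂ \ s) with hFX₂
  set HX₂ : Finset ι → Prop := fun s => ∃ w ∈ W, w ∈ Ch s ∧ w ∈ Cm (D₂ \ s) with hHX₂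
  have R0₂_iff : ∀ s, pieceR0 ends D₂ m h W s ↔ (a₂ s ∧ ¬ b₂ s ∧ NX₂ s ∧ ¬ FX₂ s) := by
    intro s; unfold pieceR0
    exact ⟨fun ⟨p, q, r, u⟩ => ⟨p, q, r, fun ⟨w, hw, hne, h1, h2⟩ => u w hw hne ⟨h1, h2⟩⟩,
      fun ⟨p, q, r, u⟩ => ⟨p, q, r, fun w hw hne hh => u ⟨w, hw, hne, hh.1, hh.2⟩⟩⟩
  have R1₂_iff : ∀ s, pieceR1 ends D₂ m h W s ↔ (a₂ s ∧ ¬ b₂ s ∧ NX₂ s ∧ FX₂ s) := by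
    intro s; unfold pieceR1; exact Iff.rfl
  have N₂_iff : ∀ s, pieceN ends D₂ m h W s ↔ (¬ a₂ s ∧ ¬ b₂ s ∧ NX₂ s ∧ ¬ HX₂ s ∧ (∃ w ∈ W, w ∈ Cm s ∧ w ∈ Ch (D₂ \ s))) := by
    intro s; unfold pieceN
    exact ⟨fun ⟨p, q, r, u, v⟩ => ⟨p, q, r, fun ⟨w, hw, h1, h2⟩ => u w hw ⟨h1, h2⟩, v⟩,
      fun ⟨p, q, r, u, v⟩ => ⟨p, q, r, fun w hw hh => u ⟨w, hw, hh.1, hh.2⟩, v⟩⟩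
  ------------------------------------------------------------------
  -- the class Z0 of D₁ (both-through, no x-core) and the class N011 of D₁
  set Z0₁ : Finset ι → Prop := fun s => a₁ s ∧ b₁ s ∧ NX₁ s with hZ0₁
  set M₁ : Finset ι → Prop := fun s => ¬ a₁ s ∧ ¬ b₁ s ∧ NX₁ s ∧ FX₁ s ∧ HX₁ s with hM₁
  -- 4. CASE ANALYSIS of a composite colouring.  For t ⊆ D put t₁ = t ∩ D₁, t₂ = t ∩ D₂.
  --    Shape lemma: the conditions "h ∉ Cx^D(D∖t)" and "no x-core" and the classes of t₁.
  ------------------------------------------------------------------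
  -- the composite clusters
  have CxD : ∀ s₁, s₁ ⊆ D₁ → ∀ s₂, s₂ ⊆ D₂ → ∀ y, (y ∈ Cx (s₁ ∪ s₂) ↔ y ∈ Cx s₁ ∨ (a₁ s₁ ∧ y ∈ Cm s₂)) := fun s₁ hs₁ s₂ hs₂ y => GX s₁ hs₁ s₂ hs₂ y
  have CxDc : ∀ s₁, s₁ ⊆ D₁ → ∀ s₂, s₂ ⊆ D₂ → ∀ y, (y ∈ Cx (D \ (s₁ ∪ s₂)) ↔ y ∈ Cx (D₁ \ s₁) ∨ (b₁ s₁ ∧ y ∈ Cm (D₂ \ s₂))) := by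
    intro s₁ hs₁ s₂ hs₂ y; rw [hsdiff s₁ hs₁ s₂ hs₂]; exact GX _ Finset.sdiff_subset _ Finset.sdiff_subset y
  have ChD : ∀ s₁, s₁ ⊆ D₁ → ∀ s₂, s₂ ⊆ D₂ → ∀ y, (y ∈ Ch (s₁ ∪ s₂) ↔ y ∈ Ch s₂ ∨ (a₂ s₂ ∧ y ∈ Cm s₁)) := by
    intro s₁ hs₁ s₂ hs₂ y; rw [GH s₁ hs₁ s₂ hs₂ y, mCh_iff]
  have ChDc : ∀ s₁, s₁ ⊆ D₁ → ∀ s₂, s₂ ⊆ D₂ → ∀ y, (y ∈ Ch (D \ (s₁ ∪ s₂)) ↔ y ∈ Ch (D₂ \ s₂) ∨ (b₂ s₂ ∧ y ∈ Cm (D₁ \ s₁))) := by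
    intro s₁ hs₁ s₂ hs₂ y; rw [hsdiff s₁ hs₁ s₂ hs₂, GH _ Finset.sdiff_subset _ Finset.sdiff_subset y, mCh_iff]
  -- h ∈ Cx(s₁∪s₂) ↔ a₁ ∧ a₂ ;  h ∈ Cx(D∖…) ↔ b₁ ∧ b₂
  have hK_iff : ∀ s₁, s₁ ⊆ D₁ → ∀ s₂, s₂ ⊆ D₂ → (h ∈ Cx (s₁ ∪ s₂) ↔ (a₁ s₁ ∧ a₂ s₂)) := by
    intro s₁ hs₁ s₂ hs₂; rw [CxD s₁ hs₁ s₂ hs₂]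
    exact ⟨fun hh => hh.elim (fun h1 => absurd h1 (h_notin_Cx1 s₁ hs₁)) id, Or.inr⟩
  have hB_iff : ∀ s₁, s₁ ⊆ D₁ → ∀ s₂, s₂ ⊆ D₂ → (h ∈ Cx (D \ (s₁ ∪ s₂)) ↔ (b₁ s₁ ∧ b₂ s₂)) := by
    intro s₁ hs₁ s₂ hs₂; rw [CxDc s₁ hs₁ s₂ hs₂]
    exact ⟨fun hh => hh.elim (fun h1 => absurd h1 (h_notin_Cx1 _ Finset.sdiff_subset)) id, Or.inr⟩
  ------------------------------------------------------------------
  -- 6. The red-through classes of the composite: shape, flag and builder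
  ------------------------------------------------------------------
  have R_shape : ∀ t, t ⊆ D → (h ∈ Cx t ∧ h ∉ Cx (D \ t) ∧ (∀ w ∈ W, ¬ (w ∈ Cx t ∧ w ∈ Cx (D \ t)))) →
      (a₁ (t ∩ D₁) ∧ a₂ (t ∩ D₂) ∧ NX₁ (t ∩ D₁) ∧
        (¬ b₁ (t ∩ D₁) ∨ (b₁ (t ∩ D₁) ∧ ¬ b₂ (t ∩ D₂) ∧ NX₂ (t ∩ D₂)))) := by
    intro t ht ⟨hhK, hhB, hNX⟩
    set t₁ := t ∩ D₁ with ht₁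
    set t₂ := t ∩ D₂ with ht₂
    have ht₁D : t₁ ⊆ D₁ := Finset.inter_subset_right
    have ht₂D : t₂ ⊆ D₂ := Finset.inter_subset_right
    have htt : t = t₁ ∪ t₂ := hdecomp t ht
    rw [htt] at hhK hhB hNX
    obtain ⟨hA1, hA2⟩ := (hK_iff t₁ ht₁D t₂ ht₂D).mp hhK
    have NX1 : NX₁ t₁ := fun w hw hh =>
      hNX w hw ⟨(CxD t₁ ht₁D t₂ ht₂D w).mpr (Or.inl hh.1), (CxDc t₁ ht₁D t₂ ht₂D w).mpr (Or.inl hh.2)⟩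
    refine ⟨hA1, hA2, NX1, ?_⟩
    by_cases hB1 : b₁ t₁
    · right
      refine ⟨hB1, fun hB2 => hhB ((hB_iff t₁ ht₁D t₂ ht₂D).mpr ⟨hB1, hB2⟩), fun w hw hh => ?_⟩
      exact hNX w hw ⟨(CxD t₁ ht₁D t₂ ht₂D w).mpr (Or.inr ⟨hA1, hh.1⟩), (CxDc t₁ ht₁D t₂ ht₂D w).mpr (Or.inr ⟨hB1, hh.2⟩)⟩
    · exact Or.inl hB1
  have R_flag : ∀ s₁, s₁ ⊆ D₁ → ∀ s₂, s₂ ⊆ D₂ → a₁ s₁ →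
      ((∃ w ∈ W, w ≠ h ∧ w ∈ Cx (s₁ ∪ s₂) ∧ w ∈ Ch (D \ (s₁ ∪ s₂))) ↔ (FX₂ s₂ ∨ (b₂ s₂ ∧ (m ∈ W ∨ FX₁ s₁)))) := by
    intro s₁ hs₁ s₂ hs₂ hA1
    constructor
    · rintro ⟨w, hw, hwh, hwK, hwP⟩
      rcases (CxD s₁ hs₁ s₂ hs₂ w).mp hwK with k1 | ⟨_, k2⟩ <;> rcases (ChDc s₁ hs₁ s₂ hs₂ w).mp hwP with p2 | ⟨hb2, p1⟩
      · rcases cross s₁ hs₁ (D₂ \ s₂) Finset.sdiff_subset x h w k1 p2 with hwx | hwh' | hwm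
        · exact absurd (hwx ▸ p2) (x_notin_Ch2 _ Finset.sdiff_subset)
        · exact absurd hwh' hwh
        · refine Or.inr ⟨(mCh_iff _).mp (by rw [← hwm]; exact p2), Or.inl (hwm ▸ hw)⟩
      · by_cases hwm : w = m
        · exact Or.inr ⟨hb2, Or.inl (hwm ▸ hw)⟩
        · exact Or.inr ⟨hb2, Or.inr ⟨w, hw, hwm, k1, p1⟩⟩
      · exact Or.inl ⟨w, hw, hwh, k2, p2⟩
      · rcases cross (D₁ \ s₁) Finset.sdiff_subset s₂ hs₂ m m w p1 k2 with hwm | hwm | hwm <;>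
          exact Or.inr ⟨hb2, Or.inl (hwm ▸ hw)⟩
    · rintro (⟨w, hw, hwh, hwM, hwP⟩ | ⟨hb2, hmW | ⟨w, hw, hwm, hwK, hwP⟩⟩)
      · exact ⟨w, hw, hwh, (CxD s₁ hs₁ s₂ hs₂ w).mpr (Or.inr ⟨hA1, hwM⟩), (ChDc s₁ hs₁ s₂ hs₂ w).mpr (Or.inl hwP)⟩
      · exact ⟨m, hmW, hmh, (CxD s₁ hs₁ s₂ hs₂ m).mpr (Or.inl hA1), (ChDc s₁ hs₁ s₂ hs₂ m).mpr (Or.inr ⟨hb2, mem_openCluster_self _ m⟩)⟩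
      · refine ⟨w, hw, fun hwh => h_notin_Cx1 s₁ hs₁ (hwh ▸ hwK), (CxD s₁ hs₁ s₂ hs₂ w).mpr (Or.inl hwK),
          (ChDc s₁ hs₁ s₂ hs₂ w).mpr (Or.inr ⟨hb2, hwP⟩)⟩
  have R_build : ∀ s₁, s₁ ⊆ D₁ → ∀ s₂, s₂ ⊆ D₂ → a₁ s₁ → a₂ s₂ → NX₁ s₁ →
      (¬ b₁ s₁ ∨ (b₁ s₁ ∧ ¬ b₂ s₂ ∧ NX₂ s₂)) →
      (h ∈ Cx (s₁ ∪ s₂) ∧ h ∉ Cx (D \ (s₁ ∪ s₂)) ∧ (∀ w ∈ W, ¬ (w ∈ Cx (s₁ ∪ s₂) ∧ w ∈ Cx (D \ (s₁ ∪ s₂))))) := by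
    intro s₁ hs₁ s₂ hs₂ hA1 hA2 hNX1 hshape
    have hxW : x ∉ W := fun hxW => hNX1 x hxW ⟨mem_openCluster_self _ x, mem_openCluster_self _ x⟩
    refine ⟨(hK_iff s₁ hs₁ s₂ hs₂).mpr ⟨hA1, hA2⟩, fun hh => ?_, ?_⟩
    · obtain ⟨hb1, hb2⟩ := (hB_iff s₁ hs₁ s₂ hs₂).mp hh
      rcases hshape with hnb1 | ⟨_, hnb2, _⟩
      · exact hnb1 hb1
      · exact hnb2 hb2
    · intro w hw hh
      obtain ⟨hwK, hwB⟩ := hh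
      rcases (CxD s₁ hs₁ s₂ hs₂ w).mp hwK with k1 | ⟨_, k2⟩ <;> rcases (CxDc s₁ hs₁ s₂ hs₂ w).mp hwB with l1 | ⟨hb1, l2⟩
      · exact hNX1 w hw ⟨k1, l1⟩
      · rcases cross s₁ hs₁ (D₂ \ s₂) Finset.sdiff_subset x m w k1 l2 with hwx | hwm | hwm
        · exact hxW (hwx ▸ hw)
        · exact hNX1 w hw ⟨k1, by rw [hwm]; exact hb1⟩
        · exact hNX1 w hw ⟨k1, by rw [hwm]; exact hb1⟩
      · rcases cross (D₁ \ s₁) Finset.sdiff_subset s₂ hs₂ x m w l1 k2 with hwx | hwm | hwm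
        · exact hxW (hwx ▸ hw)
        · exact hNX1 w hw ⟨by rw [hwm]; exact hA1, l1⟩
        · exact hNX1 w hw ⟨by rw [hwm]; exact hA1, l1⟩
      · rcases hshape with hnb1 | ⟨_, _, hNX2⟩
        · exact hnb1 hb1
        · exact hNX2 w hw ⟨k2, l2⟩
  ------------------------------------------------------------------
  ------------------------------------------------------------------
  -- the iffs
  ------------------------------------------------------------------
  have h12 : s₁ ∪ s₂ ⊆ D := Finset.union_subset_union hs₁ hs₂
  have e1 : (s₁ ∪ s₂) ∩ D₁ = s₁ := hinter₁ s₁ hs₁ s₂ hs₂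
  have e2 : (s₁ ∪ s₂) ∩ D₂ = s₂ := hinter₂ s₁ hs₁ s₂ hs₂
  -- the core condition
  have core_iff : (h ∈ Cx (s₁ ∪ s₂) ∧ h ∉ Cx (D \ (s₁ ∪ s₂)) ∧ (∀ w ∈ W, ¬ (w ∈ Cx (s₁ ∪ s₂) ∧ w ∈ Cx (D \ (s₁ ∪ s₂))))) ↔
      (a₁ s₁ ∧ a₂ s₂ ∧ NX₁ s₁ ∧ (¬ b₁ s₁ ∨ (b₁ s₁ ∧ ¬ b₂ s₂ ∧ NX₂ s₂))) := by
    constructor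
    · intro hc; have := R_shape (s₁ ∪ s₂) h12 hc; rw [e1, e2] at this; exact this
    · rintro ⟨hA1, hA2, hNX1, hsh⟩; exact R_build s₁ hs₁ s₂ hs₂ hA1 hA2 hNX1 hsh
  have hmW_of : a₁ s₁ → b₁ s₁ → NX₁ s₁ → m ∉ W := fun ha hb hNX hmW => hNX m hmW ⟨ha, hb⟩
  constructor
  · -- R0
    constructor
    · rintro ⟨hK, hB, hNX, hnf⟩
      obtain ⟨hA1, hA2, hNX1, hsh⟩ := core_iff.mp ⟨hK, hB, hNX⟩
      have hnF : ¬ (FX₂ s₂ ∨ (b₂ s₂ ∧ (m ∈ W ∨ FX₁ s₁))) := fun hh =>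
        (R_flag s₁ hs₁ s₂ hs₂ hA1).mpr hh |>.elim fun w hw => hnf w hw.1 hw.2.1 ⟨hw.2.2.1, hw.2.2.2⟩
      rcases hsh with hnb1 | ⟨hb1, hnb2, hNX2⟩
      · by_cases hF1 : FX₁ s₁
        · refine Or.inr (Or.inl ⟨(R1₁_iff s₁).mpr ⟨hA1, hnb1, hNX1, hF1⟩, hA2, fun hF2 => hnF (Or.inl hF2), fun hb2 => hnF (Or.inr ⟨hb2, Or.inr hF1⟩)⟩)
        · refine Or.inl ⟨(R0₁_iff s₁).mpr ⟨hA1, hnb1, hNX1, hF1⟩, hA2, fun hF2 => hnF (Or.inl hF2), fun hh => hnF (Or.inr ⟨hh.1, Or.inl hh.2⟩)⟩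
      · refine Or.inr (Or.inr ⟨⟨hA1, hb1, hNX1⟩, (R0₂_iff s₂).mpr ⟨hA2, hnb2, hNX2, fun hF2 => hnF (Or.inl hF2)⟩⟩)
    · rintro (⟨h0, hA2, hnF2, hnb⟩ | ⟨h1, hA2, hnF2, hnb2⟩ | ⟨hz, h0⟩)
      · obtain ⟨hA1, hnb1, hNX1, hnF1⟩ := (R0₁_iff s₁).mp h0
        obtain ⟨hK, hB, hNX⟩ := core_iff.mpr ⟨hA1, hA2, hNX1, Or.inl hnb1⟩
        refine ⟨hK, hB, hNX, fun w hw hwh hh => ?_⟩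
        rcases (R_flag s₁ hs₁ s₂ hs₂ hA1).mp ⟨w, hw, hwh, hh.1, hh.2⟩ with hF2 | ⟨hb2, hmW | hF1⟩
        · exact hnF2 hF2
        · exact hnb ⟨hb2, hmW⟩
        · exact hnF1 hF1
      · obtain ⟨hA1, hnb1, hNX1, hF1⟩ := (R1₁_iff s₁).mp h1
        obtain ⟨hK, hB, hNX⟩ := core_iff.mpr ⟨hA1, hA2, hNX1, Or.inl hnb1⟩
        refine ⟨hK, hB, hNX, fun w hw hwh hh => ?_⟩
        rcases (R_flag s₁ hs₁ s₂ hs₂ hA1).mp ⟨w, hw, hwh, hh.1, hh.2⟩ with hF2 | ⟨hb2, _⟩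
        · exact hnF2 hF2
        · exact hnb2 hb2
      · obtain ⟨hA2, hnb2, hNX2, hnF2⟩ := (R0₂_iff s₂).mp h0
        obtain ⟨hK, hB, hNX⟩ := core_iff.mpr ⟨hz.1, hA2, hz.2.2, Or.inr ⟨hz.2.1, hnb2, hNX2⟩⟩
        refine ⟨hK, hB, hNX, fun w hw hwh hh => ?_⟩
        rcases (R_flag s₁ hs₁ s₂ hs₂ hz.1).mp ⟨w, hw, hwh, hh.1, hh.2⟩ with hF2 | ⟨hb2, _⟩
        · exact hnF2 hF2
        · exact hnb2 hb2
  · -- R1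
    constructor
    · rintro ⟨hK, hB, hNX, hf⟩
      obtain ⟨hA1, hA2, hNX1, hsh⟩ := core_iff.mp ⟨hK, hB, hNX⟩
      have hF := (R_flag s₁ hs₁ s₂ hs₂ hA1).mp hf
      rcases hsh with hnb1 | ⟨hb1, hnb2, hNX2⟩
      · by_cases hF1 : FX₁ s₁
        · refine Or.inr (Or.inl ⟨(R1₁_iff s₁).mpr ⟨hA1, hnb1, hNX1, hF1⟩, hA2, hF.imp id (fun hh => hh.1)⟩)
        · refine Or.inl ⟨(R0₁_iff s₁).mpr ⟨hA1, hnb1, hNX1, hF1⟩, hA2, hF.imp id (fun hh => ⟨hh.1, hh.2.elim id (fun hF1' => absurd hF1' hF1)⟩)⟩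
      · have hF2 : FX₂ s₂ := hF.elim id (fun hh => absurd hh.1 hnb2)
        exact Or.inr (Or.inr ⟨⟨hA1, hb1, hNX1⟩, (R1₂_iff s₂).mpr ⟨hA2, hnb2, hNX2, hF2⟩⟩)
    · rintro (⟨h0, hA2, hF⟩ | ⟨h1, hA2, hF⟩ | ⟨hz, h1⟩)
      · obtain ⟨hA1, hnb1, hNX1, _⟩ := (R0₁_iff s₁).mp h0
        obtain ⟨hK, hB, hNX⟩ := core_iff.mpr ⟨hA1, hA2, hNX1, Or.inl hnb1⟩
        exact ⟨hK, hB, hNX, (R_flag s₁ hs₁ s₂ hs₂ hA1).mpr (hF.imp id (fun hh => ⟨hh.1, Or.inl hh.2⟩))⟩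
      · obtain ⟨hA1, hnb1, hNX1, hF1⟩ := (R1₁_iff s₁).mp h1
        obtain ⟨hK, hB, hNX⟩ := core_iff.mpr ⟨hA1, hA2, hNX1, Or.inl hnb1⟩
        exact ⟨hK, hB, hNX, (R_flag s₁ hs₁ s₂ hs₂ hA1).mpr (hF.imp id (fun hb2 => ⟨hb2, Or.inr hF1⟩))⟩
      · obtain ⟨hA2, hnb2, hNX2, hF2⟩ := (R1₂_iff s₂).mp h1
        obtain ⟨hK, hB, hNX⟩ := core_iff.mpr ⟨hz.1, hA2, hz.2.2, Or.inr ⟨hz.2.1, hnb2, hNX2⟩⟩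
        exact ⟨hK, hB, hNX, (R_flag s₁ hs₁ s₂ hs₂ hz.1).mpr (Or.inl hF2)⟩

end Coefficientwise

end Summit.CriticalPhenomena.PercolationContinuityZ3.Theorems
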